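import Summits.RiemannHypothesis.RiemannHypothesis.Theses.LiRephasingBarrier
import Summits.RiemannHypothesis.RiemannHypothesis.Theorems.Splittings.LiRephasingMovingCut
import HarnessLib

/-!
# Route LiRephasingBarrier (L5 «LI REPHASING GAIN BUDGET») — crux `TheoremAInftyPL` closed BY NAME (RH-FREE)

Item stmt-RiemannHypothesis-22317 is, verbatim, the type of the tree theorem
`Summit.RiemannHypothesis.RiemannHypothesis.Theorems.Splittings.LiRephasingMovingCut.theoremA_infty_PL`
(lane (xi-q) carve Q6, THEOREM A∞ with the Pólya–Landau moving cut `√n log n`). One-line closer.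
RH-free barrier-side record (B18); no summit is proved by this; nothing here bears on the truth of RH.
-/

-- D-0017: `Summit.RiemannHypothesis.RiemannHypothesis.…` duplicates the namespace BY DESIGN (single-problem summit).
set_option linter.dupNamespace false

namespace Summit.RiemannHypothesis.RiemannHypothesis.Theorems.LiRephasingBarrier

/-- **Crux `TheoremAInftyPL` (item stmt-RiemannHypothesis-22317) holds** — it is the tree theorem
`Splittings.LiRephasingMovingCut.theoremA_infty_PL` (THEOREM A∞ at the moving cut, every block
`[N_k, 2N_k)`, `N_k ≥ 260·4^k`), cited by name. RH-free. -/
theorem theoremAInftyPL_proof :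
    Summit.RiemannHypothesis.RiemannHypothesis.Theses.LiRephasingBarrier.TheoremAInftyPL :=
  fun mseq hm Kseq ↦ Splittings.LiRephasingMovingCut.theoremA_infty_PL mseq hm Kseq

end Summit.RiemannHypothesis.RiemannHypothesis.Theorems.LiRephasingBarrier
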